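import Mathlib.Analysis.Complex.PhragmenLindelof
import Mathlib.Analysis.SpecialFunctions.Pow.Deriv
import Mathlib.Analysis.Calculus.Deriv.Star
import HarnessLib

/-!
# Rademacher's Phragmén–Lindelöf theorem (explicit convexity in a vertical strip)

Trunk T-CA (`Analysis/Complex`), serving family RH / T-ANT (explicit estimates for `ζ` and
`L`-functions).  Mathlib's `PhragmenLindelof.vertical_strip` is the *qualitative* principle
(bounded by a constant `C` on both edges ⇒ bounded by `C` inside) and
`Mathlib/Analysis/Complex/Hadamard.lean` the three-lines theorem for *bounded* functions.  Explicit
analytic number theory uses instead **Rademacher's theorem** [Rademacher 1959, Thm 2]: if `f` is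
regular and of finite exponential type in `a ≤ Re s ≤ b`, `Q + a > 0`, and

  `|f(s)| ≤ A |Q + s|^α` on `Re s = a`,  `|f(s)| ≤ B |Q + s|^β` on `Re s = b`,  `α ≥ β`,

then throughout the strip

  `|f(s)| ≤ (A |Q+s|^α)^{(b−σ)/(b−a)} · (B |Q+s|^β)^{(σ−a)/(b−a)}`       (no loss of constants).

This is Lemma 2.6 of Trudgian's *Improvements to Turing's method* [Trudgian 2011] (the input to
the convexity estimate, Lemma 2.7, for `(s−1)ζ(s)` on `½ ≤ σ ≤ c` in the proof of the bound on
`∫ S(t) dt` behind Turing's method), Lemma 1 of Trudgian's `S(T)` paper, and the convexity tool of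
Bennett–Martin–O'Bryant–Rechnitzer, Hasanalizade–Shen–Wong, … .  We prove it (sorry-free):

* `Literature.Analysis.Complex.Rademacher.sq_norm_midpoint_le` — the **bisection step**: under the hypotheses, on the
  middle line `|f((a+b)/2 + it)|² ≤ A B |Q + (a+b)/2 + it|^{α+β}`.  Following Fiori [Fiori 2026,
  Lemma 5]: apply Mathlib's `PhragmenLindelof.vertical_strip` on `0 ≤ Re s ≤ b − a` to `F/H`,
  `F(s) = f(a+s) · conj f(conj(b−s))`, `H(s) = A (Q+a+s)^α · B (Q+b−s)^β` (principal powers;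
  both bases have real part `≥ Q + a > 0`); `|F/H| ≤ 1` on `Re s = 0` trivially and on
  `Re s = b − a` because `|Q+a+it| ≤ |Q+b+it|` and `α ≥ β`; at `s = (b−a)/2 + it`,
  `|F| = |f(m+it)|²`.
* `Literature.Analysis.Complex.Rademacher.norm_le_exp_mul_rpow` — induction over dyadic points of `[a, b]` (the bound
  with affine exponents is stable under bisection) and density/continuity [Fiori 2026, Thm 1].
* `Literature.Analysis.Complex.Rademacher.norm_le_interpolate` — the theorem in the displayed form, with the growth
  hypothesis in Mathlib's generality `|f| ≤ K exp(L e^{c|t|})`, `c < π/(b−a)`;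
  `Literature.Analysis.Complex.rademacher_phragmenLindelof` — **exactly as printed** in [Trudgian 2011, Lemma 2.6]
  (growth `|f| < C exp(e^{k|t|})`, `0 < k < π/(b−a)`; conclusion
  `A^{(b−σ)/(b−a)} B^{(σ−a)/(b−a)} |Q+s|^{α(b−σ)/(b−a)+β(σ−a)/(b−a)}`);
  `Literature.Analysis.Complex.rademacher_phragmenLindelof_of_finiteOrder` — under finite-order growth
  `|f| ≤ C exp(|t|^c)`, the form in which Rademacher's Theorem 2 is usually quoted.

"Regular in the closed strip" is taken in Mathlib's weaker form `DiffContOnCl ℂ f (re ⁻¹' Ioo a b)`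
(holomorphic inside, continuous up to the boundary).  We assume `A, B > 0` (implicit in the
sources, which take logarithms).  Trudgian prints the side condition as `−Q ≤ a`; Rademacher's
`Q + a > 0` is what is needed (for `Q + a = 0` the bound `|Q+s|^α` degenerates at `s = a`) and is
what every application uses (`Q = 0, a = ½` in [Trudgian 2011, proof of Lemma 2.7]).

## References

* H. Rademacher, *On the Phragmén–Lindelöf theorem and some applications*, Math. Z. 72 (1959),
  192–204, Theorem 2.  [Rademacher1959]
* T. S. Trudgian, *Improvements to Turing's method*, Math. Comp. 80 (2011), 2259–2279, Lemma 2.6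
  (and Lemma 2.7 for the application to `ζ`).  [Trudgian2011]
* A. Fiori, *A note on the Phragmén–Lindelöf theorem*, J. Math. Anal. Appl. 559 (2026), 130404,
  arXiv:2502.13282, Theorem 1 and Lemma 5 (the bisection proof used here).  [Fiori2026]
* M. A. Bennett, G. Martin, K. O'Bryant, A. Rechnitzer, *Counting zeros of Dirichlet
  `L`-functions*, Math. Comp. 90 (2021), Lemma 5.6 (Rademacher's convexity bound in use).
-/

noncomputable section

open Complex Real Set Filter Topology Asymptotics
open scoped ComplexConjugate

namespace Literature.Analysis.Complex

namespace Rademacher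

/-! ### Auxiliary real estimates -/

/-- `x ^ r ≤ (m₀ ^ r + (m₁ + 1) ^ |r|) · exp (|r| |t|)` whenever `0 < m₀ ≤ x ≤ m₁ + |t|`
(crude polynomial-to-exponential domination, any real `r`). [folklore] -/
private lemma rpow_le_of_mem_Icc {x m₀ m₁ t : ℝ} (hm₀ : 0 < m₀) (hm₁ : 0 ≤ m₁) (hx : m₀ ≤ x)
    (hx' : x ≤ m₁ + |t|) (r : ℝ) :
    x ^ r ≤ (m₀ ^ r + (m₁ + 1) ^ |r|) * Real.exp (|r| * |t|) := by
  have hx0 : 0 < x := hm₀.trans_le hx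
  have hE : 1 ≤ Real.exp (|r| * |t|) := Real.one_le_exp (by positivity)
  have h1 : 0 ≤ m₀ ^ r := (Real.rpow_pos_of_pos hm₀ r).le
  have h2 : 0 ≤ (m₁ + 1) ^ |r| := Real.rpow_nonneg (by linarith) _
  rcases le_or_gt 0 r with hr | hr
  · -- `r ≥ 0`: monotone in the base
    have habs : |r| = r := abs_of_nonneg hr
    have hle : x ≤ (m₁ + 1) * (1 + |t|) := by nlinarith [abs_nonneg t]
    calc x ^ r ≤ ((m₁ + 1) * (1 + |t|)) ^ r := Real.rpow_le_rpow hx0.le hle hr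
      _ = (m₁ + 1) ^ r * (1 + |t|) ^ r := Real.mul_rpow (by linarith) (by positivity)
      _ ≤ (m₁ + 1) ^ |r| * Real.exp (|r| * |t|) := by
          rw [habs]
          refine mul_le_mul_of_nonneg_left ?_ (habs ▸ h2)
          calc (1 + |t|) ^ r ≤ (Real.exp |t|) ^ r :=
                Real.rpow_le_rpow (by positivity) (by linarith [Real.add_one_le_exp |t|]) hr
            _ = Real.exp (r * |t|) := by rw [← Real.exp_mul, mul_comm]
      _ ≤ (m₀ ^ r + (m₁ + 1) ^ |r|) * Real.exp (|r| * |t|) := by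
          refine mul_le_mul_of_nonneg_right ?_ (by positivity); linarith
  · -- `r < 0`: antitone in the base
    calc x ^ r ≤ m₀ ^ r := Real.rpow_le_rpow_of_nonpos hm₀ hx hr.le
      _ ≤ (m₀ ^ r + (m₁ + 1) ^ |r|) * 1 := by linarith
      _ ≤ (m₀ ^ r + (m₁ + 1) ^ |r|) * Real.exp (|r| * |t|) :=
          mul_le_mul_of_nonneg_left hE (by positivity)

/-- Absorbing a polynomial-exponential bound into the Phragmén–Lindelöf normal form
`exp (B · exp (c |t|))` (`c > 0`). [folklore] -/
private lemma mul_exp_le_exp_exp {C₀ P L c t : ℝ} (hC : 0 ≤ C₀) (hP : 0 ≤ P) (hc : 0 < c) :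
    C₀ * Real.exp (P * |t|) * Real.exp (L * Real.exp (c * |t|)) ≤
      Real.exp ((C₀ + P / c + L) * Real.exp (c * |t|)) := by
  set E := Real.exp (c * |t|) with hE
  have hE1 : 1 ≤ E := Real.one_le_exp (by positivity)
  have ht : |t| ≤ E / c := by
    rw [le_div_iff₀ hc]
    have := Real.add_one_le_exp (c * |t|)
    nlinarith
  have h1 : C₀ ≤ Real.exp (C₀ * E) := by
    calc C₀ ≤ C₀ + 1 := by linarith
      _ ≤ Real.exp C₀ := Real.add_one_le_exp C₀
      _ ≤ Real.exp (C₀ * E) := Real.exp_le_exp.2 (by nlinarith)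
  have h2 : Real.exp (P * |t|) ≤ Real.exp (P / c * E) := by
    refine Real.exp_le_exp.2 ?_
    calc P * |t| ≤ P * (E / c) := mul_le_mul_of_nonneg_left ht hP
      _ = P / c * E := by ring
  calc C₀ * Real.exp (P * |t|) * Real.exp (L * E)
      ≤ Real.exp (C₀ * E) * Real.exp (P / c * E) * Real.exp (L * E) := by
        gcongr
    _ = Real.exp ((C₀ + P / c + L) * E) := by
        rw [← Real.exp_add, ← Real.exp_add]; ring_nf

/-- The inequality behind the right edge: `x ^ β · y ^ α ≤ x ^ α · y ^ β` for `0 < y ≤ x`,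
`β ≤ α`. [folklore] -/
private lemma rpow_mul_rpow_le_swap {x y α β : ℝ} (hy : 0 < y) (hyx : y ≤ x) (hβα : β ≤ α) :
    x ^ β * y ^ α ≤ x ^ α * y ^ β := by
  have hx : 0 < x := hy.trans_le hyx
  have e1 : y ^ α = y ^ β * y ^ (α - β) := by
    rw [← Real.rpow_add hy]; ring_nf
  have e2 : x ^ α = x ^ β * x ^ (α - β) := by
    rw [← Real.rpow_add hx]; ring_nf
  rw [e1, e2]
  have : y ^ (α - β) ≤ x ^ (α - β) := Real.rpow_le_rpow hy.le hyx (sub_nonneg.2 hβα)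
  calc x ^ β * (y ^ β * y ^ (α - β)) = (x ^ β * y ^ β) * y ^ (α - β) := by ring
    _ ≤ (x ^ β * y ^ β) * x ^ (α - β) := by gcongr
    _ = x ^ β * x ^ (α - β) * y ^ β := by ring

/-! ### The conjugate-reflected function -/

/-- The reflected function `f̄(w) = conj (f (conj w))` is holomorphic in a vertical strip and
continuous on its closure together with `f` (Schwarz-reflection bookkeeping; Mathlib
`differentiableAt_conj_conj_iff`). [folklore] -/
lemma diffContOnCl_conj_conj {f : ℂ → ℂ} {a b : ℝ} (hfd : DiffContOnCl ℂ f (re ⁻¹' Ioo a b)) :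
    DiffContOnCl ℂ (fun w ↦ conj (f (conj w))) (re ⁻¹' Ioo a b) := by
  refine ⟨fun w hw ↦ ?_, ?_⟩
  · have hw' : conj w ∈ re ⁻¹' Ioo a b := by simpa using hw
    have hd : DifferentiableAt ℂ f (conj w) :=
      hfd.differentiableAt (isOpen_Ioo.preimage continuous_re) hw'
    have := (differentiableAt_conj_conj_iff (f := f) (x := w)).2 hd
    exact this.differentiableWithinAt
  · have hc : ContinuousOn f (closure (re ⁻¹' Ioo a b)) := hfd.continuousOn
    refine (continuous_conj.comp_continuousOn (hc.comp continuous_conj.continuousOn ?_))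
    intro w hw
    rw [closure_preimage_re] at hw ⊢
    simpa using hw

/-! ### The midpoint step -/

/-- **Bisection step** (Fiori's form of Rademacher's argument).  If `f` is of finite exponential
type in the strip `a < Re s < b`, `|f| ≤ A|Q+s|^α` on `Re s = a` and `|f| ≤ B|Q+s|^β` on `Re s = b`
with `Q + a > 0` and `β ≤ α`, then on the middle line `Re s = (a+b)/2` one has
`|f(s)|² ≤ A B |Q+s|^{α+β}`.  Proof: the standard Phragmén–Lindelöf principle
(`PhragmenLindelof.vertical_strip`) applied on `0 ≤ Re s ≤ b − a` to
`F(s)/H(s)`, `F(s) = f(a+s) conj f(conj (b − s))`, `H(s) = A (Q+a+s)^α B (Q+b−s)^β`.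
[cite: Fiori2026, Lemma 5] -/
theorem sq_norm_midpoint_le {f : ℂ → ℂ} {a b Q A B α β c K L : ℝ} (hab : a < b)
    (hQ : 0 < Q + a) (hA : 0 < A) (hB : 0 < B) (hβα : β ≤ α)
    (hfd : DiffContOnCl ℂ f (re ⁻¹' Ioo a b)) (hc0 : 0 < c) (hc : c < π / (b - a))
    (hgr : ∀ z : ℂ, a < z.re → z.re < b → ‖f z‖ ≤ K * Real.exp (L * Real.exp (c * |z.im|)))
    (ha : ∀ z : ℂ, z.re = a → ‖f z‖ ≤ A * ‖(Q : ℂ) + z‖ ^ α)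
    (hb : ∀ z : ℂ, z.re = b → ‖f z‖ ≤ B * ‖(Q : ℂ) + z‖ ^ β) (t : ℝ) :
    ‖f (((a + b) / 2 : ℝ) + t * I)‖ ^ 2 ≤
      A * B * ‖(Q : ℂ) + (((a + b) / 2 : ℝ) + t * I)‖ ^ (α + β) := by
  set δ : ℝ := b - a with hδ
  have hδ0 : 0 < δ := sub_pos.2 hab
  -- the two auxiliary functions
  set F : ℂ → ℂ := fun s ↦ f (a + s) * conj (f (conj ((b : ℂ) - s))) with hF
  set H : ℂ → ℂ := fun s ↦ (A : ℂ) * (((Q + a : ℝ) : ℂ) + s) ^ (α : ℂ) *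
    ((B : ℂ) * (((Q + b : ℝ) : ℂ) - s) ^ (β : ℂ)) with hH
  -- positivity of the real parts of the two bases on the closed strip `0 ≤ Re s ≤ δ`
  have hre1 : ∀ s : ℂ, 0 ≤ s.re → 0 < ((((Q + a : ℝ) : ℂ) + s)).re := by
    intro s hs; simp only [add_re, ofReal_re]; linarith
  have hre2 : ∀ s : ℂ, s.re ≤ δ → 0 < ((((Q + b : ℝ) : ℂ) - s)).re := by
    intro s hs; simp only [sub_re, ofReal_re]; linarith
  have hHnorm : ∀ s : ℂ, ‖H s‖ = A * ‖(((Q + a : ℝ) : ℂ) + s)‖ ^ α *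
      (B * ‖(((Q + b : ℝ) : ℂ) - s)‖ ^ β) := by
    intro s
    simp only [hH, norm_mul, norm_cpow_real, Complex.norm_of_nonneg hA.le,
      Complex.norm_of_nonneg hB.le]
  have hH0 : ∀ s : ℂ, 0 ≤ s.re → s.re ≤ δ → H s ≠ 0 := by
    intro s h1 h2
    have n1 : (((Q + a : ℝ) : ℂ) + s) ≠ 0 := fun h ↦ by
      have := congrArg Complex.re h; simp at this; linarith [hre1 s h1]
    have n2 : (((Q + b : ℝ) : ℂ) - s) ≠ 0 := fun h ↦ by
      have := congrArg Complex.re h; simp at this; linarith [hre2 s h2]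
    simp only [hH]
    refine mul_ne_zero (mul_ne_zero (by exact_mod_cast hA.ne') (cpow_ne_zero_iff.2 (Or.inl n1)))
      (mul_ne_zero (by exact_mod_cast hB.ne') (cpow_ne_zero_iff.2 (Or.inl n2)))
  -- `H` is differentiable at every point of the closed strip
  have hHdiff : ∀ s : ℂ, 0 ≤ s.re → s.re ≤ δ → DifferentiableAt ℂ H s := by
    intro s h1 h2
    have m1 : (((Q + a : ℝ) : ℂ) + s) ∈ slitPlane := Or.inl (hre1 s h1)
    have m2 : (((Q + b : ℝ) : ℂ) - s) ∈ slitPlane := Or.inl (hre2 s h2)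
    simp only [hH]
    exact ((differentiableAt_const _).mul ((differentiableAt_id.const_add _).cpow_const m1)).mul
      ((differentiableAt_const _).mul ((differentiableAt_id.const_sub _).cpow_const m2))
  -- `F` is differentiable on the open strip and continuous on its closure
  have hmaps1 : MapsTo (fun s : ℂ ↦ (a : ℂ) + s) (re ⁻¹' Ioo 0 δ) (re ⁻¹' Ioo a b) := by
    intro s hs
    simp only [mem_preimage, mem_Ioo, add_re, ofReal_re] at hs ⊢
    constructor <;> linarith [hs.1, hs.2]
  have hmaps2 : MapsTo (fun s : ℂ ↦ (b : ℂ) - s) (re ⁻¹' Ioo 0 δ) (re ⁻¹' Ioo a b) := by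
    intro s hs
    simp only [mem_preimage, mem_Ioo, sub_re, ofReal_re] at hs ⊢
    constructor <;> linarith [hs.1, hs.2]
  have hF1 : DiffContOnCl ℂ (fun s ↦ f (a + s)) (re ⁻¹' Ioo 0 δ) :=
    hfd.comp ((differentiable_id.const_add _).diffContOnCl) hmaps1
  have hF2 : DiffContOnCl ℂ (fun s ↦ conj (f (conj ((b : ℂ) - s)))) (re ⁻¹' Ioo 0 δ) :=
    (diffContOnCl_conj_conj hfd).comp ((differentiable_id.const_sub _).diffContOnCl) hmaps2
  have hclos : closure (re ⁻¹' Ioo 0 δ) = re ⁻¹' Icc 0 δ := by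
    rw [closure_preimage_re, closure_Ioo hδ0.ne]
  have hFd : DiffContOnCl ℂ F (re ⁻¹' Ioo 0 δ) :=
    ⟨hF1.differentiableOn.mul hF2.differentiableOn, hF1.continuousOn.mul hF2.continuousOn⟩
  -- hence so is `G = F / H`
  have hGd : DiffContOnCl ℂ (fun s ↦ F s / H s) (re ⁻¹' Ioo 0 δ) := by
    refine ⟨hFd.differentiableOn.div (fun s hs ↦ ?_) (fun s hs ↦ ?_),
      hFd.continuousOn.div (fun s hs ↦ ?_) (fun s hs ↦ ?_)⟩
    · simp only [mem_preimage, mem_Ioo] at hs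
      exact (hHdiff s hs.1.le hs.2.le).differentiableWithinAt
    · simp only [mem_preimage, mem_Ioo] at hs
      exact hH0 s hs.1.le hs.2.le
    · rw [hclos] at hs; simp only [mem_preimage, mem_Icc] at hs
      exact (hHdiff s hs.1 hs.2).continuousAt.continuousWithinAt
    · rw [hclos] at hs; simp only [mem_preimage, mem_Icc] at hs
      exact hH0 s hs.1 hs.2
  -- `K ≥ 0` (the strip is nonempty)
  have hK : 0 ≤ K := by
    have h := hgr (((a + b) / 2 : ℝ) : ℂ) (by simp; linarith) (by simp; linarith)
    have : 0 < Real.exp (L * Real.exp (c * |(((a + b) / 2 : ℝ) : ℂ).im|)) := Real.exp_pos _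
    nlinarith [norm_nonneg (f (((a + b) / 2 : ℝ) : ℂ))]
  -- growth of `G` on the open strip
  set m₁ : ℝ := Q + b with hm₁
  have hm₁0 : 0 ≤ m₁ := by simp only [hm₁]; linarith
  set C₀ : ℝ := K ^ 2 * (A⁻¹ * ((Q + a) ^ (-α) + (m₁ + 1) ^ |-α|)) *
    (B⁻¹ * ((Q + a) ^ (-β) + (m₁ + 1) ^ |-β|)) with hC₀
  have hC₀0 : 0 ≤ C₀ := by positivity
  have hGbound : ∀ s : ℂ, 0 < s.re → s.re < δ →
      ‖F s / H s‖ ≤ Real.exp ((C₀ + (|-α| + |-β|) / c + 2 * L) * Real.exp (c * |s.im|)) := by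
    intro s h1 h2
    -- the numerator
    have e1 : ‖f (a + s)‖ ≤ K * Real.exp (L * Real.exp (c * |s.im|)) := by
      have := hgr (a + s) (by simp; linarith) (by simp; linarith)
      simpa using this
    have e2 : ‖conj (f (conj ((b : ℂ) - s)))‖ ≤ K * Real.exp (L * Real.exp (c * |s.im|)) := by
      have := hgr (conj ((b : ℂ) - s)) (by simp; linarith) (by simp; linarith)
      rw [Complex.norm_conj]
      simpa [abs_neg] using this
    have eF : ‖F s‖ ≤ (K * Real.exp (L * Real.exp (c * |s.im|))) ^ 2 := by
      simp only [hF, norm_mul]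
      rw [sq]
      exact mul_le_mul e1 e2 (norm_nonneg _) (by positivity)
    -- the denominator
    have x1lo : Q + a ≤ ‖(((Q + a : ℝ) : ℂ) + s)‖ := by
      refine le_trans ?_ (abs_re_le_norm _)
      simp only [add_re, ofReal_re]; rw [abs_of_pos (by linarith)]; linarith
    have x1hi : ‖(((Q + a : ℝ) : ℂ) + s)‖ ≤ m₁ + |s.im| := by
      refine (norm_le_abs_re_add_abs_im _).trans ?_
      simp only [add_re, ofReal_re, add_im, ofReal_im, zero_add]
      rw [abs_of_pos (by linarith)]; simp only [hm₁]; linarith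
    have x2lo : Q + a ≤ ‖(((Q + b : ℝ) : ℂ) - s)‖ := by
      refine le_trans ?_ (abs_re_le_norm _)
      simp only [sub_re, ofReal_re]; rw [abs_of_pos (by linarith)]; linarith
    have x2hi : ‖(((Q + b : ℝ) : ℂ) - s)‖ ≤ m₁ + |s.im| := by
      refine (norm_le_abs_re_add_abs_im _).trans ?_
      simp only [sub_re, ofReal_re, sub_im, ofReal_im, zero_sub, abs_neg]
      rw [abs_of_pos (by linarith)]; simp only [hm₁]; linarith [abs_nonneg s.im]
    have p1 := rpow_le_of_mem_Icc hQ hm₁0 x1lo x1hi (-α)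
    have p2 := rpow_le_of_mem_Icc hQ hm₁0 x2lo x2hi (-β)
    have hHs : ‖H s‖ = A * ‖(((Q + a : ℝ) : ℂ) + s)‖ ^ α * (B * ‖(((Q + b : ℝ) : ℂ) - s)‖ ^ β) :=
      hHnorm s
    have hx1 : 0 < ‖(((Q + a : ℝ) : ℂ) + s)‖ := hQ.trans_le x1lo
    have hx2 : 0 < ‖(((Q + b : ℝ) : ℂ) - s)‖ := hQ.trans_le x2lo
    have hHpos : 0 < ‖H s‖ := by rw [hHs]; positivity
    have hinv : ‖H s‖⁻¹ = A⁻¹ * ‖(((Q + a : ℝ) : ℂ) + s)‖ ^ (-α) *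
        (B⁻¹ * ‖(((Q + b : ℝ) : ℂ) - s)‖ ^ (-β)) := by
      rw [hHs, Real.rpow_neg hx1.le, Real.rpow_neg hx2.le]
      simp [mul_assoc, mul_comm, mul_left_comm]
    rw [norm_div, div_eq_mul_inv, hinv]
    set E := Real.exp (c * |s.im|) with hE
    calc ‖F s‖ * (A⁻¹ * ‖(((Q + a : ℝ) : ℂ) + s)‖ ^ (-α) * (B⁻¹ * ‖(((Q + b : ℝ) : ℂ) - s)‖ ^ (-β)))
        ≤ (K * Real.exp (L * E)) ^ 2 *
          (A⁻¹ * (((Q + a) ^ (-α) + (m₁ + 1) ^ |-α|) * Real.exp (|-α| * |s.im|)) *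
          (B⁻¹ * (((Q + a) ^ (-β) + (m₁ + 1) ^ |-β|) * Real.exp (|-β| * |s.im|)))) := by
          gcongr
      _ = C₀ * Real.exp ((|-α| + |-β|) * |s.im|) * Real.exp ((2 * L) * E) := by
          simp only [hC₀]
          have : Real.exp ((|-α| + |-β|) * |s.im|) =
              Real.exp (|-α| * |s.im|) * Real.exp (|-β| * |s.im|) := by
            rw [← Real.exp_add]; ring_nf
          rw [this, mul_pow, sq (Real.exp (L * E)), ← Real.exp_add]
          ring_nf
      _ ≤ Real.exp ((C₀ + (|-α| + |-β|) / c + 2 * L) * E) :=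
          mul_exp_le_exp_exp hC₀0 (by positivity) hc0
  -- the edges
  have hedge0 : ∀ s : ℂ, s.re = 0 → ‖F s / H s‖ ≤ 1 := by
    intro s hs
    have hH0' := hH0 s hs.symm.le (by rw [hs]; exact hδ0.le)
    rw [norm_div, div_le_one (norm_pos_iff.2 hH0'), hHnorm s]
    have e1 : ‖f (a + s)‖ ≤ A * ‖(((Q + a : ℝ) : ℂ) + s)‖ ^ α := by
      have := ha (a + s) (by simp [hs])
      convert this using 3; push_cast; ring
    have e2 : ‖conj (f (conj ((b : ℂ) - s)))‖ ≤ B * ‖(((Q + b : ℝ) : ℂ) - s)‖ ^ β := by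
      have := hb (conj ((b : ℂ) - s)) (by simp [hs])
      rw [Complex.norm_conj]
      convert this using 3
      rw [← Complex.norm_conj (((Q + b : ℝ) : ℂ) - s)]; congr 1
      apply Complex.ext <;> simp; ring
    simp only [hF, norm_mul]
    exact mul_le_mul e1 e2 (norm_nonneg _) (by positivity)
  have hedgeδ : ∀ s : ℂ, s.re = δ → ‖F s / H s‖ ≤ 1 := by
    intro s hs
    have hH0' := hH0 s (by rw [hs]; exact hδ0.le) hs.le
    rw [norm_div, div_le_one (norm_pos_iff.2 hH0'), hHnorm s]
    -- on this edge the rôles of the two lines are swapped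
    have e1 : ‖f (a + s)‖ ≤ B * ‖(((Q + a : ℝ) : ℂ) + s)‖ ^ β := by
      have := hb (a + s) (by simp [hs, hδ])
      convert this using 3; push_cast; ring
    have e2 : ‖conj (f (conj ((b : ℂ) - s)))‖ ≤ A * ‖(((Q + b : ℝ) : ℂ) - s)‖ ^ α := by
      have := ha (conj ((b : ℂ) - s)) (by simp [hs, hδ])
      rw [Complex.norm_conj]
      convert this using 3
      rw [← Complex.norm_conj (((Q + b : ℝ) : ℂ) - s)]; congr 1
      apply Complex.ext <;> simp; ring
    have hyx : ‖(((Q + b : ℝ) : ℂ) - s)‖ ≤ ‖(((Q + a : ℝ) : ℂ) + s)‖ := by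
      have h1 : (((Q + b : ℝ) : ℂ) - s) = ((Q + a : ℝ) : ℂ) + ((-s.im : ℝ) : ℂ) * I := by
        apply Complex.ext <;> simp [hs, hδ]; ring
      have h2 : (((Q + a : ℝ) : ℂ) + s) = ((Q + b : ℝ) : ℂ) + ((s.im : ℝ) : ℂ) * I := by
        apply Complex.ext <;> simp [hs, hδ]
      rw [h1, h2, Complex.norm_add_mul_I, Complex.norm_add_mul_I]
      refine Real.sqrt_le_sqrt ?_
      nlinarith
    have hy : 0 < ‖(((Q + b : ℝ) : ℂ) - s)‖ := by
      refine hQ.trans_le (le_trans ?_ (abs_re_le_norm _))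
      simp only [sub_re, ofReal_re, hs, hδ]; rw [abs_of_pos (by linarith)]; linarith
    simp only [hF, norm_mul]
    calc ‖f (a + s)‖ * ‖conj (f (conj ((b : ℂ) - s)))‖
        ≤ (B * ‖(((Q + a : ℝ) : ℂ) + s)‖ ^ β) * (A * ‖(((Q + b : ℝ) : ℂ) - s)‖ ^ α) :=
          mul_le_mul e1 e2 (norm_nonneg _) (by positivity)
      _ = A * B * (‖(((Q + a : ℝ) : ℂ) + s)‖ ^ β * ‖(((Q + b : ℝ) : ℂ) - s)‖ ^ α) := by ring
      _ ≤ A * B * (‖(((Q + a : ℝ) : ℂ) + s)‖ ^ α * ‖(((Q + b : ℝ) : ℂ) - s)‖ ^ β) :=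
          mul_le_mul_of_nonneg_left (rpow_mul_rpow_le_swap hy hyx hβα) (by positivity)
      _ = A * ‖(((Q + a : ℝ) : ℂ) + s)‖ ^ α * (B * ‖(((Q + b : ℝ) : ℂ) - s)‖ ^ β) := by ring
  -- Phragmén–Lindelöf on `0 ≤ Re s ≤ δ`
  set s₀ : ℂ := ((δ / 2 : ℝ) : ℂ) + t * I with hs₀
  have hPL : ‖F s₀ / H s₀‖ ≤ 1 := by
    refine PhragmenLindelof.vertical_strip (f := fun s ↦ F s / H s) hGd ?_ hedge0 hedgeδ
      (by simp [hs₀]; linarith) (by simp [hs₀]; linarith)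
    refine ⟨c, by simpa using hc, C₀ + (|-α| + |-β|) / c + 2 * L, ?_⟩
    refine IsBigO.of_bound 1 ?_
    rw [eventually_inf_principal]
    refine Eventually.of_forall fun s hs ↦ ?_
    simp only [mem_preimage, mem_Ioo] at hs
    rw [one_mul, Real.norm_of_nonneg (Real.exp_pos _).le]
    exact hGbound s hs.1 hs.2
  -- evaluation at the midpoint
  have hH0' : H s₀ ≠ 0 := hH0 s₀ (by simp [hs₀]; linarith) (by simp [hs₀]; linarith)
  rw [norm_div, div_le_one (norm_pos_iff.2 hH0')] at hPL
  set m : ℂ := (((a + b) / 2 : ℝ) : ℂ) + t * I with hm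
  have k1 : (a : ℂ) + s₀ = m := by
    simp only [hs₀, hm, hδ]; push_cast; ring
  have k2 : conj ((b : ℂ) - s₀) = m := by
    apply Complex.ext <;>
      simp only [hs₀, hm, hδ, conj_re, conj_im, sub_re, sub_im, add_re, add_im, ofReal_re,
        ofReal_im, mul_re, mul_im, I_re, I_im] <;> ring
  have k3 : ((Q + a : ℝ) : ℂ) + s₀ = (Q : ℂ) + m := by
    simp only [hs₀, hm, hδ]; push_cast; ring
  have k4 : ((Q + b : ℝ) : ℂ) - s₀ = conj ((Q : ℂ) + m) := by
    apply Complex.ext <;>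
      simp only [hs₀, hm, hδ, conj_re, conj_im, sub_re, sub_im, add_re, add_im, ofReal_re,
        ofReal_im, mul_re, mul_im, I_re, I_im] <;> ring
  have hFm : ‖F s₀‖ = ‖f m‖ ^ 2 := by
    simp only [hF, k1, k2, norm_mul, Complex.norm_conj, sq]
  have hQm : 0 < ‖(Q : ℂ) + m‖ := by
    refine hQ.trans_le (le_trans ?_ (abs_re_le_norm _))
    simp only [hm, add_re, ofReal_re, mul_re, I_re, I_im, ofReal_im]
    rw [abs_of_pos (by linarith)]; linarith
  have hHm : ‖H s₀‖ = A * B * ‖(Q : ℂ) + m‖ ^ (α + β) := by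
    rw [hHnorm s₀, k3, k4, Complex.norm_conj, Real.rpow_add hQm]; ring
  rw [hFm, hHm] at hPL
  exact hPL


/-! ### Bisection, density, and the theorem -/

/-- **Rademacher's Phragmén–Lindelöf theorem**, multiplicative form with the affine exponents
written out: under the hypotheses of `norm_le_interpolate`, for `a ≤ Re z ≤ b`,
`‖f z‖ ≤ exp (κ(Re z)) · ‖Q + z‖ ^ ℓ(Re z)` where `κ`, `ℓ` are the affine functions interpolating
`(log A, log B)` and `(α, β)` between `a` and `b`.  Bisection over the dyadic points of `[a, b]`
(`sq_norm_midpoint_le`; the affine bound is stable under bisection because `ℓ` is non-increasing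
when `β ≤ α`) and density/continuity. [cite: Fiori2026, Thm 1] [cite: Rademacher1959, Thm 2] -/
theorem norm_le_exp_mul_rpow {f : ℂ → ℂ} {a b Q A B α β : ℝ} (hab : a < b)
    (hQ : 0 < Q + a) (hA : 0 < A) (hB : 0 < B) (hβα : β ≤ α)
    (hfd : DiffContOnCl ℂ f (re ⁻¹' Ioo a b))
    (hgr : ∃ c < π / (b - a), ∃ K L : ℝ,
      ∀ z : ℂ, a < z.re → z.re < b → ‖f z‖ ≤ K * Real.exp (L * Real.exp (c * |z.im|)))
    (ha : ∀ z : ℂ, z.re = a → ‖f z‖ ≤ A * ‖(Q : ℂ) + z‖ ^ α)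
    (hb : ∀ z : ℂ, z.re = b → ‖f z‖ ≤ B * ‖(Q : ℂ) + z‖ ^ β)
    {z : ℂ} (hza : a ≤ z.re) (hzb : z.re ≤ b) :
    ‖f z‖ ≤ Real.exp (Real.log A * ((b - z.re) / (b - a)) + Real.log B * ((z.re - a) / (b - a))) *
      ‖(Q : ℂ) + z‖ ^ (α * ((b - z.re) / (b - a)) + β * ((z.re - a) / (b - a))) := by
  have hba : 0 < b - a := sub_pos.2 hab
  -- normalise the growth hypothesis: `0 < c`, `0 ≤ L`
  obtain ⟨c, hc, K, L, hKL⟩ := hgr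
  obtain ⟨c', hc'0, hc', L', hgr'⟩ : ∃ c', 0 < c' ∧ c' < π / (b - a) ∧ ∃ L',
      ∀ z : ℂ, a < z.re → z.re < b → ‖f z‖ ≤ K * Real.exp (L' * Real.exp (c' * |z.im|)) := by
    have hπ : 0 < π / (b - a) := div_pos Real.pi_pos hba
    refine ⟨max c (π / (b - a) / 2), lt_max_of_lt_right (by linarith), max_lt hc (by linarith),
      max L 0, fun z h1 h2 ↦ (hKL z h1 h2).trans ?_⟩
    have hK : 0 ≤ K := by
      have h := hKL z h1 h2
      have : 0 < Real.exp (L * Real.exp (c * |z.im|)) := Real.exp_pos _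
      nlinarith [norm_nonneg (f z)]
    refine mul_le_mul_of_nonneg_left (Real.exp_le_exp.2 ?_) hK
    rcases le_or_gt 0 L with hL | hL
    · rw [max_eq_left hL]
      exact mul_le_mul_of_nonneg_left (Real.exp_le_exp.2
        (mul_le_mul_of_nonneg_right (le_max_left _ _) (abs_nonneg _))) hL
    · rw [max_eq_right hL.le, zero_mul]
      exact mul_nonpos_of_nonpos_of_nonneg hL.le (Real.exp_pos _).le |>.trans le_rfl
  clear hKL hc c L
  -- the affine exponents
  set ℓ : ℝ → ℝ := fun σ ↦ α * ((b - σ) / (b - a)) + β * ((σ - a) / (b - a)) with hℓ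
  set κ : ℝ → ℝ := fun σ ↦ Real.log A * ((b - σ) / (b - a)) + Real.log B * ((σ - a) / (b - a))
    with hκ
  have hℓ_anti : ∀ σ₁ σ₂, σ₁ ≤ σ₂ → ℓ σ₂ ≤ ℓ σ₁ := by
    intro σ₁ σ₂ h
    have : ℓ σ₂ - ℓ σ₁ = (β - α) * ((σ₂ - σ₁) / (b - a)) := by
      simp only [hℓ]; field_simp; ring
    have : (β - α) * ((σ₂ - σ₁) / (b - a)) ≤ 0 :=
      mul_nonpos_of_nonpos_of_nonneg (sub_nonpos.2 hβα) (div_nonneg (sub_nonneg.2 h) hba.le)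
    linarith
  -- the statement on a vertical line
  let P : ℝ → Prop := fun σ ↦ a ≤ σ ∧ σ ≤ b ∧
    ∀ t : ℝ, ‖f (σ + t * I)‖ ≤ Real.exp (κ σ) * ‖(Q : ℂ) + (σ + t * I)‖ ^ ℓ σ
  have hPa : P a := by
    refine ⟨le_rfl, hab.le, fun t ↦ ?_⟩
    have h1 : κ a = Real.log A := by simp only [hκ]; field_simp; ring
    have h2 : ℓ a = α := by simp only [hℓ]; field_simp; ring
    rw [h1, h2, Real.exp_log hA]
    exact ha _ (by simp)
  have hPb : P b := by
    refine ⟨hab.le, le_rfl, fun t ↦ ?_⟩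
    have h1 : κ b = Real.log B := by simp only [hκ]; field_simp; ring
    have h2 : ℓ b = β := by simp only [hℓ]; field_simp; ring
    rw [h1, h2, Real.exp_log hB]
    exact hb _ (by simp)
  -- bisection step
  have hstep : ∀ σ₁ σ₂, σ₁ < σ₂ → P σ₁ → P σ₂ → P ((σ₁ + σ₂) / 2) := by
    intro σ₁ σ₂ h12 hP1 hP2
    obtain ⟨h1a, h1b, H1⟩ := hP1
    obtain ⟨h2a, h2b, H2⟩ := hP2
    refine ⟨by linarith, by linarith, fun t ↦ ?_⟩
    have hsub : σ₂ - σ₁ ≤ b - a := by linarith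
    have hc2 : c' < π / (σ₂ - σ₁) :=
      hc'.trans_le (div_le_div_of_nonneg_left Real.pi_pos.le (sub_pos.2 h12) hsub)
    have hfd' : DiffContOnCl ℂ f (re ⁻¹' Ioo σ₁ σ₂) :=
      hfd.mono (preimage_mono (Ioo_subset_Ioo h1a h2b))
    have key := sq_norm_midpoint_le (f := f) (Q := Q) (A := Real.exp (κ σ₁))
      (B := Real.exp (κ σ₂)) (α := ℓ σ₁) (β := ℓ σ₂) (K := K) h12 (by linarith)
      (Real.exp_pos _) (Real.exp_pos _) (hℓ_anti _ _ h12.le) hfd' hc'0 hc2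
      (fun z hz1 hz2 ↦ hgr' z (by linarith) (by linarith))
      (fun z hz ↦ by
        have e : z = (σ₁ : ℂ) + z.im * I := by apply Complex.ext <;> simp [hz]
        rw [e]; exact H1 z.im)
      (fun z hz ↦ by
        have e : z = (σ₂ : ℂ) + z.im * I := by apply Complex.ext <;> simp [hz]
        rw [e]; exact H2 z.im) t
    -- take square roots using affinity of `κ` and `ℓ`
    set m : ℝ := (σ₁ + σ₂) / 2 with hm
    set r : ℝ := ‖(Q : ℂ) + ((m : ℂ) + t * I)‖ with hr
    have hr0 : 0 < r := by
      refine lt_of_lt_of_le (by linarith : 0 < Q + m) (le_trans ?_ (abs_re_le_norm _))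
      simp only [add_re, ofReal_re, mul_re, I_re, I_im, ofReal_im]
      rw [abs_of_pos (by linarith)]; linarith
    have hκm : κ σ₁ + κ σ₂ = 2 * κ m := by simp only [hκ, hm]; field_simp; ring
    have hℓm : ℓ σ₁ + ℓ σ₂ = 2 * ℓ m := by simp only [hℓ, hm]; field_simp; ring
    have hsq : ‖f ((m : ℂ) + t * I)‖ ^ 2 ≤ (Real.exp (κ m) * r ^ ℓ m) ^ 2 := by
      calc ‖f ((m : ℂ) + t * I)‖ ^ 2 ≤ Real.exp (κ σ₁) * Real.exp (κ σ₂) * r ^ (ℓ σ₁ + ℓ σ₂) :=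
            key
        _ = (Real.exp (κ m) * r ^ ℓ m) ^ 2 := by
            rw [← Real.exp_add, hκm, hℓm, mul_pow, ← Real.exp_nat_mul, ← Real.rpow_natCast,
              ← Real.rpow_mul hr0.le]
            push_cast; ring_nf
    exact le_of_sq_le_sq hsq (by positivity)
  -- all dyadic points
  have hdy : ∀ k n : ℕ, n ≤ 2 ^ k → P (a + (b - a) * (n / 2 ^ k)) := by
    intro k
    induction k with
    | zero =>
      intro n hn
      interval_cases n
      · simpa using hPa
      · simpa using hPb
    | succ k IH =>
      intro n hn
      rcases Nat.even_or_odd n with ⟨n', rfl⟩ | ⟨n', rfl⟩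
      · have hn' : n' ≤ 2 ^ k := by rw [pow_succ] at hn; omega
        have := IH n' hn'
        convert this using 3
        push_cast; field_simp; ring
      · have hn' : n' + 1 ≤ 2 ^ k := by rw [pow_succ] at hn; omega
        have hP1 := IH n' (by omega)
        have hP2 := IH (n' + 1) hn'
        have hlt : a + (b - a) * ((n' : ℕ) / 2 ^ k : ℝ) < a + (b - a) * ((n' + 1 : ℕ) / 2 ^ k : ℝ) := by
          push_cast
          gcongr
          linarith
        have := hstep _ _ hlt hP1 hP2
        convert this using 2
        push_cast; field_simp; ring
  -- density: approximate `Re z` by dyadic points from below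
  set σ : ℝ := z.re with hσdef
  set t : ℝ := z.im with htdef
  have hzσt : z = (σ : ℂ) + t * I := by apply Complex.ext <;> simp [hσdef, htdef]
  let nk : ℕ → ℕ := fun k ↦ ⌊(σ - a) / (b - a) * 2 ^ k⌋₊
  let σk : ℕ → ℝ := fun k ↦ a + (b - a) * ((nk k : ℝ) / 2 ^ k)
  have hθ0 : 0 ≤ (σ - a) / (b - a) := div_nonneg (by linarith) hba.le
  have hθ1 : (σ - a) / (b - a) ≤ 1 := (div_le_one hba).2 (by linarith)
  have hnk : ∀ k, nk k ≤ 2 ^ k := by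
    intro k
    have : ((nk k : ℕ) : ℝ) ≤ 2 ^ k := by
      refine (Nat.floor_le (by positivity)).trans ?_
      calc (σ - a) / (b - a) * 2 ^ k ≤ 1 * 2 ^ k := by gcongr
        _ = 2 ^ k := one_mul _
    exact_mod_cast this
  have hσk_le : ∀ k, σk k ≤ σ := by
    intro k
    have h1 : ((nk k : ℕ) : ℝ) ≤ (σ - a) / (b - a) * 2 ^ k := Nat.floor_le (by positivity)
    have h2 : ((nk k : ℕ) : ℝ) / 2 ^ k ≤ (σ - a) / (b - a) := by
      rw [div_le_iff₀ (by positivity)]; exact h1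
    calc σk k = a + (b - a) * ((nk k : ℝ) / 2 ^ k) := rfl
      _ ≤ a + (b - a) * ((σ - a) / (b - a)) := by gcongr
      _ = σ := by field_simp; ring
  have hσk_ge : ∀ k, σ - (b - a) / 2 ^ k ≤ σk k := by
    intro k
    have h1 : (σ - a) / (b - a) * 2 ^ k < (nk k : ℕ) + 1 := Nat.lt_floor_add_one _
    have h2 : (σ - a) / (b - a) - 1 / 2 ^ k ≤ (nk k : ℝ) / 2 ^ k := by
      rw [sub_le_iff_le_add, ← add_div, le_div_iff₀ (by positivity)]
      exact h1.le
    calc σ - (b - a) / 2 ^ k = a + (b - a) * ((σ - a) / (b - a) - 1 / 2 ^ k) := by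
          field_simp; ring
      _ ≤ a + (b - a) * ((nk k : ℝ) / 2 ^ k) := by gcongr
      _ = σk k := rfl
  have hσk_tendsto : Tendsto σk atTop (𝓝 σ) := by
    have h0 : Tendsto (fun k : ℕ ↦ σ - (b - a) / 2 ^ k) atTop (𝓝 σ) := by
      have : Tendsto (fun k : ℕ ↦ (b - a) / 2 ^ k) atTop (𝓝 0) := by
        have h := (tendsto_pow_atTop_nhds_zero_of_lt_one (r := (1 / 2 : ℝ))
          (by norm_num) (by norm_num)).const_mul (b - a)
        rw [mul_zero] at h
        refine h.congr fun k ↦ ?_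
        rw [one_div, inv_pow, div_eq_mul_inv]
      simpa using this.const_sub σ
    exact tendsto_of_tendsto_of_tendsto_of_le_of_le h0 tendsto_const_nhds hσk_ge hσk_le
  have hσk_mem : ∀ k, σk k ∈ Icc a b := fun k ↦
    ⟨le_add_of_nonneg_right (by positivity), (hσk_le k).trans hzb⟩
  -- continuity of both sides along `σ' ↦ σ' + t I`
  have hcont_f : ContinuousOn (fun σ' : ℝ ↦ ‖f ((σ' : ℂ) + t * I)‖) (Icc a b) := by
    have hc : ContinuousOn f (re ⁻¹' Icc a b) := by
      have := hfd.continuousOn; rwa [closure_preimage_re, closure_Ioo hab.ne] at this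
    refine (hc.comp (by fun_prop) ?_).norm
    intro σ' hσ'; simpa using hσ'
  have hcont_g : ContinuousOn
      (fun σ' : ℝ ↦ Real.exp (κ σ') * ‖(Q : ℂ) + ((σ' : ℂ) + t * I)‖ ^ ℓ σ') (Icc a b) := by
    refine ContinuousOn.mul (by simp only [hκ]; fun_prop) (ContinuousOn.rpow ?_ ?_ ?_)
    · fun_prop
    · simp only [hℓ]; fun_prop
    · intro σ' hσ'
      left
      refine (lt_of_lt_of_le (by linarith [hσ'.1] : 0 < Q + σ') (le_trans ?_ (abs_re_le_norm _))).ne'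
      simp only [add_re, ofReal_re, mul_re, I_re, I_im, ofReal_im]
      rw [abs_of_pos (by linarith [hσ'.1])]; linarith
  have hσmem : σ ∈ Icc a b := ⟨hza, hzb⟩
  have lim_f : Tendsto (fun k ↦ ‖f ((σk k : ℂ) + t * I)‖) atTop (𝓝 ‖f ((σ : ℂ) + t * I)‖) :=
    ((hcont_f σ hσmem).tendsto.comp
      (tendsto_nhdsWithin_iff.2 ⟨hσk_tendsto, Eventually.of_forall hσk_mem⟩))
  have lim_g : Tendsto (fun k ↦ Real.exp (κ (σk k)) * ‖(Q : ℂ) + ((σk k : ℂ) + t * I)‖ ^ ℓ (σk k))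
      atTop (𝓝 (Real.exp (κ σ) * ‖(Q : ℂ) + ((σ : ℂ) + t * I)‖ ^ ℓ σ)) :=
    ((hcont_g σ hσmem).tendsto.comp
      (tendsto_nhdsWithin_iff.2 ⟨hσk_tendsto, Eventually.of_forall hσk_mem⟩))
  have hle : ∀ k, ‖f ((σk k : ℂ) + t * I)‖ ≤
      Real.exp (κ (σk k)) * ‖(Q : ℂ) + ((σk k : ℂ) + t * I)‖ ^ ℓ (σk k) :=
    fun k ↦ (hdy k (nk k) (hnk k)).2.2 t
  have := le_of_tendsto_of_tendsto' lim_f lim_g hle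
  rw [hzσt]
  simpa only [hκ, hℓ, add_re, ofReal_re, mul_re, I_re, I_im, ofReal_im, mul_zero, sub_zero,
    zero_mul, add_zero] using this


/-- **Rademacher's Phragmén–Lindelöf theorem** [cite: Rademacher1959, Thm 2], in the form printed
as [cite: Trudgian2011, Lemma 2.6] but with the growth hypothesis in Mathlib's
(`PhragmenLindelof.vertical_strip`) generality.  Let `f` be holomorphic in the open strip
`a < Re s < b` and continuous on its closure, of growth `|f(s)| ≤ K exp (L e^{c|t|})` there for some
`c < π/(b − a)`; let `Q + a > 0`, `A, B > 0`, `α ≥ β`, and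
`|f(s)| ≤ A |Q+s|^α` on `Re s = a`, `|f(s)| ≤ B |Q+s|^β` on `Re s = b`.  Then for `a ≤ Re s ≤ b`,
`|f(s)| ≤ (A|Q+s|^α)^{(b−σ)/(b−a)} (B|Q+s|^β)^{(σ−a)/(b−a)}`.
Proof after [cite: Fiori2026, Thm 1, Lemma 5] (bisection + continuity; `norm_le_exp_mul_rpow`). -/
theorem norm_le_interpolate {f : ℂ → ℂ} {a b Q A B α β : ℝ} (hab : a < b)
    (hQ : 0 < Q + a) (hA : 0 < A) (hB : 0 < B) (hβα : β ≤ α)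
    (hfd : DiffContOnCl ℂ f (re ⁻¹' Ioo a b))
    (hgr : ∃ c < π / (b - a), ∃ K L : ℝ,
      ∀ z : ℂ, a < z.re → z.re < b → ‖f z‖ ≤ K * Real.exp (L * Real.exp (c * |z.im|)))
    (ha : ∀ z : ℂ, z.re = a → ‖f z‖ ≤ A * ‖(Q : ℂ) + z‖ ^ α)
    (hb : ∀ z : ℂ, z.re = b → ‖f z‖ ≤ B * ‖(Q : ℂ) + z‖ ^ β)
    {z : ℂ} (hza : a ≤ z.re) (hzb : z.re ≤ b) :
    ‖f z‖ ≤ (A * ‖(Q : ℂ) + z‖ ^ α) ^ ((b - z.re) / (b - a)) *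
      (B * ‖(Q : ℂ) + z‖ ^ β) ^ ((z.re - a) / (b - a)) := by
  have h := norm_le_exp_mul_rpow hab hQ hA hB hβα hfd hgr ha hb hza hzb
  set p : ℝ := (b - z.re) / (b - a)
  set q : ℝ := (z.re - a) / (b - a)
  set r : ℝ := ‖(Q : ℂ) + z‖ with hr
  have hr0 : 0 < r := by
    refine lt_of_lt_of_le (by linarith : 0 < Q + z.re) (le_trans ?_ (abs_re_le_norm _))
    simp only [add_re, ofReal_re]
    rw [abs_of_pos (by linarith)]
  convert h using 1
  rw [Real.mul_rpow hA.le (Real.rpow_nonneg hr0.le _), Real.mul_rpow hB.le (Real.rpow_nonneg hr0.le _),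
    ← Real.rpow_mul hr0.le, ← Real.rpow_mul hr0.le, Real.rpow_def_of_pos hA,
    Real.rpow_def_of_pos hB, Real.exp_add, Real.rpow_add hr0]
  ring

end Rademacher

/-- **Rademacher's Phragmén–Lindelöf theorem, as printed in** [cite: Trudgian2011, Lemma 2.6]
(= [cite: Rademacher1959, Thm 2]; also Trudgian, *A modest improvement on the function `S(T)`*,
Math. Comp. 81 (2012), Lemma 1): let `a < b`, `Q + a > 0` and let `f` be regular in the strip
`a ≤ σ ≤ b` (here: holomorphic in the open strip, continuous on the closed strip) with
`|f(s)| < C exp (e^{k|t|})` for some `C > 0` and `0 < k < π/(b − a)`; assume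
`|f(s)| ≤ A|Q+s|^α` for `Re s = a` and `|f(s)| ≤ B|Q+s|^β` for `Re s = b`, with `α ≥ β`
(and `A, B > 0`).  Then throughout `a ≤ σ ≤ b`,
`|f(s)| ≤ A^{(b−σ)/(b−a)} B^{(σ−a)/(b−a)} |Q+s|^{α(b−σ)/(b−a) + β(σ−a)/(b−a)}`. -/
theorem rademacher_phragmenLindelof {f : ℂ → ℂ} {a b Q A B α β C k : ℝ} (hab : a < b)
    (hQ : 0 < Q + a) (hA : 0 < A) (hB : 0 < B) (hβα : β ≤ α)
    (hfd : DiffContOnCl ℂ f (re ⁻¹' Ioo a b))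
    (hC : 0 < C) (hk0 : 0 < k) (hk : k < π / (b - a))
    (hgr : ∀ z : ℂ, a ≤ z.re → z.re ≤ b → ‖f z‖ < C * Real.exp (Real.exp (k * |z.im|)))
    (ha : ∀ z : ℂ, z.re = a → ‖f z‖ ≤ A * ‖(Q : ℂ) + z‖ ^ α)
    (hb : ∀ z : ℂ, z.re = b → ‖f z‖ ≤ B * ‖(Q : ℂ) + z‖ ^ β)
    {z : ℂ} (hza : a ≤ z.re) (hzb : z.re ≤ b) :
    ‖f z‖ ≤ A ^ ((b - z.re) / (b - a)) * B ^ ((z.re - a) / (b - a)) *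
      ‖(Q : ℂ) + z‖ ^ (α * ((b - z.re) / (b - a)) + β * ((z.re - a) / (b - a))) := by
  have _ := hC; have _ := hk0
  have h := Rademacher.norm_le_exp_mul_rpow hab hQ hA hB hβα hfd
    ⟨k, hk, C, 1, fun z h1 h2 ↦ by simpa using (hgr z h1.le h2.le).le⟩ ha hb hza hzb
  rwa [Real.exp_add, ← Real.rpow_def_of_pos hA, ← Real.rpow_def_of_pos hB] at h

/-- Rademacher's theorem under a **finite-order** growth hypothesis `|f(s)| ≤ C exp (|t|^c)`
(`c > 0`), the form in which [cite: Rademacher1959, Thm 2] is usually quoted (any finite order is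
admissible in a strip of any width); reduced to `Rademacher.norm_le_interpolate` through
`|t|^c ≤ (c/k)^c exp (k|t|)` with `k = π/(2(b−a))`. -/
theorem rademacher_phragmenLindelof_of_finiteOrder {f : ℂ → ℂ} {a b Q A B α β C c : ℝ}
    (hab : a < b) (hQ : 0 < Q + a) (hA : 0 < A) (hB : 0 < B) (hβα : β ≤ α)
    (hfd : DiffContOnCl ℂ f (re ⁻¹' Ioo a b)) (hc : 0 < c)
    (hgr : ∀ z : ℂ, a < z.re → z.re < b → ‖f z‖ ≤ C * Real.exp (|z.im| ^ c))
    (ha : ∀ z : ℂ, z.re = a → ‖f z‖ ≤ A * ‖(Q : ℂ) + z‖ ^ α)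
    (hb : ∀ z : ℂ, z.re = b → ‖f z‖ ≤ B * ‖(Q : ℂ) + z‖ ^ β)
    {z : ℂ} (hza : a ≤ z.re) (hzb : z.re ≤ b) :
    ‖f z‖ ≤ (A * ‖(Q : ℂ) + z‖ ^ α) ^ ((b - z.re) / (b - a)) *
      (B * ‖(Q : ℂ) + z‖ ^ β) ^ ((z.re - a) / (b - a)) := by
  have hba : 0 < b - a := sub_pos.2 hab
  set k : ℝ := π / (b - a) / 2 with hk
  have hk0 : 0 < k := by positivity
  have hklt : k < π / (b - a) := by
    have : 0 < π / (b - a) := div_pos Real.pi_pos hba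
    rw [hk]; linarith
  refine Rademacher.norm_le_interpolate hab hQ hA hB hβα hfd
    ⟨k, hklt, max C 0, (c / k) ^ c, ?_⟩ ha hb hza hzb
  intro w h1 h2
  refine (hgr w h1 h2).trans ?_
  -- `|t|^c ≤ (c/k)^c · exp (k|t|)` (maximise `u^c e^{-ku}`; i.e. `log x ≤ x - 1`)
  have key : |w.im| ^ c ≤ (c / k) ^ c * Real.exp (k * |w.im|) := by
    rcases (abs_nonneg w.im).eq_or_lt with h0 | hpos
    · rw [← h0, Real.zero_rpow hc.ne']; positivity
    · have hck : 0 < c / k := div_pos hc hk0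
      have hx : 0 < |w.im| * k / c := by positivity
      have hlog : Real.log (|w.im| * k / c) ≤ |w.im| * k / c - 1 := Real.log_le_sub_one_of_pos hx
      have hsplit : Real.log |w.im| = Real.log (|w.im| * k / c) + Real.log (c / k) := by
        rw [← Real.log_mul hx.ne' hck.ne']; congr 1; field_simp
      rw [Real.rpow_def_of_pos hpos, Real.rpow_def_of_pos hck, ← Real.exp_add, hsplit]
      refine Real.exp_le_exp.2 ?_
      have h3 : c * Real.log (|w.im| * k / c) ≤ c * (|w.im| * k / c - 1) :=
        mul_le_mul_of_nonneg_left hlog hc.le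
      have h4 : c * (|w.im| * k / c - 1) = k * |w.im| - c := by field_simp
      nlinarith
  calc C * Real.exp (|w.im| ^ c) ≤ max C 0 * Real.exp (|w.im| ^ c) := by
        gcongr; exact le_max_left _ _
    _ ≤ max C 0 * Real.exp ((c / k) ^ c * Real.exp (k * |w.im|)) := by
        gcongr

end Literature.Analysis.Complex
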